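import Summits.AtomisticToContinuum.HydrodynamicLimit.Theorems.LambertianContactSwapLambertianEulerPairShellVel
import Summits.AtomisticToContinuum.HydrodynamicLimit.Theorems.LambertianContactSwapLambertianEulerTailsZero
import HarnessLib

/-!
# The static fast-pair shell with Gaussian weights under the equilibrium law
# (`LambertianContactSwap.LambertianEuler`, stmt-AtomisticToContinuum-11854, line `Sketch`;
# sub-goal `lintegral_fastPairShell_le` of the equilibrium floor of the marked Korolyuk bound)

Under the homogeneous local Gibbs law `G` of `N + 1` hard spheres of diameter
`ε = hsDiameter σ N` on `𝕋³` (constant profiles `b, ϑ > 0`, `w`; positions hard-core canonical,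
velocities i.i.d. Maxwellian `N(w, ϑ id)` — `localGibbsMeasure_rung0_eq_map`), the `ε`-weighted
kinetic content of a FAST pair `i ≠ l` in the velocity-width shell,

  `∫ 𝟙{ε ≤ d(xᵢ, x_l) ≤ ε + δ‖vᵢ − v_l‖} · 𝟙{V² < 1 + ‖vᵢ‖² + ‖v_l‖²} · ε (1 + ‖vᵢ‖² + ‖v_l‖²) dG`,

is at most `ε (A e^{−aV²} ε² δ + C₂ δ²)` with `A, a > 0` depending on `w, ϑ` only (uniform in
`N`, `σ`, `b`, the pair and `V ≥ 1`) and `C₂ = C₂(w, ϑ, ε)`.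

Route (the route of `…PairShellVel.localGibbsLaw_pairShellVel_le`, with the velocity weight kept
inside).  Write `G` as the image of `posGibbs ⊗ (⊗ᵢ N(w, ϑ id))` under `zipConfig` and integrate
the positions first (Tonelli in the inequality form `lintegral_prod_le`, no measurability
needed): for fixed velocities the integrand is the indicator of the pair shell of width
`δ‖vᵢ − v_l‖` times the velocity weight, so `posGibbsMeasure_pairShell_le` bounds the inner
integral by `W · (12 v₁ ε² δ g + K(ε) δ² g²)`, `g = ‖vᵢ − v_l‖`, `W = 𝟙{V² < t} ε t`,
`t = 1 + ‖vᵢ‖² + ‖v_l‖²`.  Pointwise `g ≤ ‖vᵢ‖ + ‖v_l‖ ≤ t` and `g² ≤ 2t`, so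
`W (⋯) ≤ ε (12 v₁ ε² δ + 2 K δ²) 𝟙{V² < t} t²`, and the GAUSSIAN TAIL
`𝟙{V² < t} t² ≤ c⁻² e^{4c} e^{−2cV²} (e^{8c‖vᵢ‖²} + e^{8c‖v_l‖²})/2` (`sq_le_exp_tail`: `ct ≤ e^{ct}`,
`1 ≤ e^{2c(t − V²)}`, AM–GM) reduces everything to the one-body exponential moment
`∫ e^{8c‖v‖²} dN(w, ϑ id) ≤ K₁` of Fernique's theorem
(`tailsZero_exists_lintegral_exp_gaussMeasure_le`, `8c = a₀`), transported to the coordinates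
`i`, `l` of the product Maxwellian by `measurePreserving_eval`.  Constants:
`A = 12 v₁ c⁻² e^{4c} K₁`, `a = 2c`, `C₂ = 2 K(ε) c⁻² e^{4c} K₁ + 1`.

References: Cercignani–Illner–Pulvirenti 1994 §2.2 (collision cylinder); Gallagher–Saint-Raymond–
Texier 2013, Lemma 4.1.2; X. Fernique, C. R. Acad. Sci. Paris 270 (1970).
-/

noncomputable section

open scoped BigOperators Topology ENNReal InnerProductSpace
open MeasureTheory ProbabilityTheory Filter Set
open Literature.MathematicalPhysics.KineticTheory Literature.MathematicalPhysics.StatisticalMechanics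
open Literature.Analysis.FluidPDE

namespace Summit.AtomisticToContinuum.HydrodynamicLimit.Theorems.LambertianContactSwapLambertianEulerFastPairShell

open LambertianContactSwapLambertianEulerTailsZero

/-! ## The Gaussian tail of the fast-pair weight (scalar inequalities) -/

/-- **Polynomial weight under an exponential tail.**  For `c > 0` and `V² < t := 1 + x² + y²`:
`t² ≤ c⁻² e^{4c} e^{−2cV²} · (e^{8cx²} + e^{8cy²})/2` — from `ct ≤ e^{ct}` (squared),
`1 ≤ e^{2c(t − V²)}` on the fast region, and `e^{4cx²} e^{4cy²} ≤ (e^{8cx²} + e^{8cy²})/2`.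
[folklore] -/
theorem sq_le_exp_tail {c : ℝ} (hc : 0 < c) (x y V : ℝ) (hV : V ^ 2 < 1 + x ^ 2 + y ^ 2) :
    (1 + x ^ 2 + y ^ 2) ^ 2 ≤ c⁻¹ ^ 2 * Real.exp (4 * c) * Real.exp (-(2 * c * V ^ 2)) *
      ((Real.exp (8 * c * x ^ 2) + Real.exp (8 * c * y ^ 2)) / 2) := by
  have h1 : c * (1 + x ^ 2 + y ^ 2) ≤ Real.exp (c * (1 + x ^ 2 + y ^ 2)) := by
    linarith [Real.add_one_le_exp (c * (1 + x ^ 2 + y ^ 2))]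
  have h2 : (c * (1 + x ^ 2 + y ^ 2)) * (c * (1 + x ^ 2 + y ^ 2)) ≤
      Real.exp (c * (1 + x ^ 2 + y ^ 2)) * Real.exp (c * (1 + x ^ 2 + y ^ 2)) :=
    mul_self_le_mul_self (by positivity) h1
  have h3 : (1 : ℝ) ≤ Real.exp (2 * c * (1 + x ^ 2 + y ^ 2 - V ^ 2)) :=
    Real.one_le_exp (mul_nonneg (by positivity) (by linarith))
  have key : Real.exp (c * (1 + x ^ 2 + y ^ 2)) * Real.exp (c * (1 + x ^ 2 + y ^ 2)) *
      Real.exp (2 * c * (1 + x ^ 2 + y ^ 2 - V ^ 2)) =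
      Real.exp (4 * c) * Real.exp (-(2 * c * V ^ 2)) *
        (Real.exp (4 * c * x ^ 2) * Real.exp (4 * c * y ^ 2)) := by
    simp only [← Real.exp_add]
    congr 1
    ring
  have hamgm : Real.exp (4 * c * x ^ 2) * Real.exp (4 * c * y ^ 2) ≤
      (Real.exp (8 * c * x ^ 2) + Real.exp (8 * c * y ^ 2)) / 2 := by
    have hx2 : Real.exp (8 * c * x ^ 2) = Real.exp (4 * c * x ^ 2) * Real.exp (4 * c * x ^ 2) := by
      rw [← Real.exp_add]
      congr 1
      ring
    have hy2 : Real.exp (8 * c * y ^ 2) = Real.exp (4 * c * y ^ 2) * Real.exp (4 * c * y ^ 2) := by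
      rw [← Real.exp_add]
      congr 1
      ring
    rw [hx2, hy2]
    nlinarith [sq_nonneg (Real.exp (4 * c * x ^ 2) - Real.exp (4 * c * y ^ 2))]
  have h4 : c ^ 2 * (1 + x ^ 2 + y ^ 2) ^ 2 ≤ Real.exp (4 * c) * Real.exp (-(2 * c * V ^ 2)) *
      ((Real.exp (8 * c * x ^ 2) + Real.exp (8 * c * y ^ 2)) / 2) :=
    calc c ^ 2 * (1 + x ^ 2 + y ^ 2) ^ 2
        = (c * (1 + x ^ 2 + y ^ 2)) * (c * (1 + x ^ 2 + y ^ 2)) := by ring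
      _ ≤ Real.exp (c * (1 + x ^ 2 + y ^ 2)) * Real.exp (c * (1 + x ^ 2 + y ^ 2)) := h2
      _ ≤ Real.exp (c * (1 + x ^ 2 + y ^ 2)) * Real.exp (c * (1 + x ^ 2 + y ^ 2)) *
            Real.exp (2 * c * (1 + x ^ 2 + y ^ 2 - V ^ 2)) :=
          le_mul_of_one_le_right (by positivity) h3
      _ = Real.exp (4 * c) * Real.exp (-(2 * c * V ^ 2)) *
            (Real.exp (4 * c * x ^ 2) * Real.exp (4 * c * y ^ 2)) := key
      _ ≤ _ := mul_le_mul_of_nonneg_left hamgm (by positivity)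
  have h5 : c⁻¹ ^ 2 * (c ^ 2 * (1 + x ^ 2 + y ^ 2) ^ 2) = (1 + x ^ 2 + y ^ 2) ^ 2 := by
    rw [← mul_assoc, ← mul_pow, inv_mul_cancel₀ hc.ne', one_pow, one_mul]
  calc (1 + x ^ 2 + y ^ 2) ^ 2 = c⁻¹ ^ 2 * (c ^ 2 * (1 + x ^ 2 + y ^ 2) ^ 2) := h5.symm
    _ ≤ c⁻¹ ^ 2 * (Real.exp (4 * c) * Real.exp (-(2 * c * V ^ 2)) *
          ((Real.exp (8 * c * x ^ 2) + Real.exp (8 * c * y ^ 2)) / 2)) :=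
        mul_le_mul_of_nonneg_left h4 (by positivity)
    _ = _ := by ring

/-- **Pointwise bound of the weighted pair window.**  With `t = 1 + ‖vᵢ‖² + ‖v_l‖²`,
`g = ‖vᵢ − v_l‖ ≤ ‖vᵢ‖ + ‖v_l‖ ≤ t`, `g² ≤ 2t`, and `P, Q, ε, δ ≥ 0`:
`𝟙{V² < t} ε t · (P δ g + Q δ² g²) ≤ ε (Pδ + 2Qδ²) 𝟙{V² < t} t²`, and the Gaussian tail
`sq_le_exp_tail` bounds `𝟙{V² < t} t²`. [folklore] -/
theorem weight_mul_window_le {c : ℝ} (hc : 0 < c) {ε δ P Q : ℝ} (hε : 0 ≤ ε) (hδ : 0 ≤ δ)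
    (hP : 0 ≤ P) (hQ : 0 ≤ Q) (V : ℝ) (vi vl : V3) :
    (if V ^ 2 < 1 + ‖vi‖ ^ 2 + ‖vl‖ ^ 2 then ε * (1 + ‖vi‖ ^ 2 + ‖vl‖ ^ 2) else 0) *
        (P * (δ * ‖vi - vl‖) + Q * (δ * ‖vi - vl‖) ^ 2) ≤
      ε * ((P * δ + 2 * Q * δ ^ 2) * (c⁻¹ ^ 2 * Real.exp (4 * c) * Real.exp (-(2 * c * V ^ 2)))) / 2 *
        (Real.exp (8 * c * ‖vi‖ ^ 2) + Real.exp (8 * c * ‖vl‖ ^ 2)) := by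
  split_ifs with hV
  · have hg : ‖vi - vl‖ ≤ ‖vi‖ + ‖vl‖ := norm_sub_le _ _
    have hg0 : 0 ≤ ‖vi - vl‖ := norm_nonneg _
    have hx : 0 ≤ ‖vi‖ := norm_nonneg _
    have hy : 0 ≤ ‖vl‖ := norm_nonneg _
    have ht : 0 ≤ 1 + ‖vi‖ ^ 2 + ‖vl‖ ^ 2 := by positivity
    have hxy : ‖vi‖ + ‖vl‖ ≤ 1 + ‖vi‖ ^ 2 + ‖vl‖ ^ 2 := by
      nlinarith [sq_nonneg (‖vi‖ - 1), sq_nonneg (‖vl‖ - 1)]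
    have hg1 : ‖vi - vl‖ ≤ 1 + ‖vi‖ ^ 2 + ‖vl‖ ^ 2 := hg.trans hxy
    have hg2 : ‖vi - vl‖ ^ 2 ≤ 2 * (1 + ‖vi‖ ^ 2 + ‖vl‖ ^ 2) := by
      have h1 : ‖vi - vl‖ ^ 2 ≤ (‖vi‖ + ‖vl‖) ^ 2 := pow_le_pow_left₀ hg0 hg 2
      nlinarith [sq_nonneg (‖vi‖ - ‖vl‖)]
    have hstep : (1 + ‖vi‖ ^ 2 + ‖vl‖ ^ 2) * (P * (δ * ‖vi - vl‖) + Q * (δ * ‖vi - vl‖) ^ 2) ≤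
        (P * δ + 2 * Q * δ ^ 2) * (1 + ‖vi‖ ^ 2 + ‖vl‖ ^ 2) ^ 2 := by
      have h1 : (1 + ‖vi‖ ^ 2 + ‖vl‖ ^ 2) * ‖vi - vl‖ ≤
          (1 + ‖vi‖ ^ 2 + ‖vl‖ ^ 2) * (1 + ‖vi‖ ^ 2 + ‖vl‖ ^ 2) :=
        mul_le_mul_of_nonneg_left hg1 ht
      have h2 : (1 + ‖vi‖ ^ 2 + ‖vl‖ ^ 2) * ‖vi - vl‖ ^ 2 ≤
          (1 + ‖vi‖ ^ 2 + ‖vl‖ ^ 2) * (2 * (1 + ‖vi‖ ^ 2 + ‖vl‖ ^ 2)) :=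
        mul_le_mul_of_nonneg_left hg2 ht
      have h1' := mul_le_mul_of_nonneg_left h1 (mul_nonneg hP hδ)
      have h2' := mul_le_mul_of_nonneg_left h2 (mul_nonneg hQ (sq_nonneg δ))
      nlinarith [h1', h2']
    have htail := sq_le_exp_tail hc ‖vi‖ ‖vl‖ V hV
    have hR : 0 ≤ P * δ + 2 * Q * δ ^ 2 := by positivity
    calc ε * (1 + ‖vi‖ ^ 2 + ‖vl‖ ^ 2) * (P * (δ * ‖vi - vl‖) + Q * (δ * ‖vi - vl‖) ^ 2)
        = ε * ((1 + ‖vi‖ ^ 2 + ‖vl‖ ^ 2) *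
            (P * (δ * ‖vi - vl‖) + Q * (δ * ‖vi - vl‖) ^ 2)) := by ring
      _ ≤ ε * ((P * δ + 2 * Q * δ ^ 2) * (1 + ‖vi‖ ^ 2 + ‖vl‖ ^ 2) ^ 2) :=
          mul_le_mul_of_nonneg_left hstep hε
      _ ≤ ε * ((P * δ + 2 * Q * δ ^ 2) * (c⁻¹ ^ 2 * Real.exp (4 * c) *
            Real.exp (-(2 * c * V ^ 2)) *
              ((Real.exp (8 * c * ‖vi‖ ^ 2) + Real.exp (8 * c * ‖vl‖ ^ 2)) / 2))) :=
          mul_le_mul_of_nonneg_left (mul_le_mul_of_nonneg_left htail hR) hε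
      _ = _ := by ring
  · rw [zero_mul]
    positivity

/-- `ℝ≥0∞` form of `weight_mul_window_le` (the two factors of the disintegrated integrand are
`ofReal` of nonnegative reals). [folklore] -/
theorem ofReal_weight_mul_window_le {c : ℝ} (hc : 0 < c) {ε δ P Q : ℝ} (hε : 0 ≤ ε)
    (hδ : 0 ≤ δ) (hP : 0 ≤ P) (hQ : 0 ≤ Q) (V : ℝ) (vi vl : V3) :
    ENNReal.ofReal (if V ^ 2 < 1 + ‖vi‖ ^ 2 + ‖vl‖ ^ 2 then ε * (1 + ‖vi‖ ^ 2 + ‖vl‖ ^ 2)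
          else 0) *
        ENNReal.ofReal (P * (δ * ‖vi - vl‖) + Q * (δ * ‖vi - vl‖) ^ 2) ≤
      ENNReal.ofReal (ε * ((P * δ + 2 * Q * δ ^ 2) *
          (c⁻¹ ^ 2 * Real.exp (4 * c) * Real.exp (-(2 * c * V ^ 2)))) / 2) *
        (ENNReal.ofReal (Real.exp (8 * c * ‖vi‖ ^ 2)) +
          ENNReal.ofReal (Real.exp (8 * c * ‖vl‖ ^ 2))) := by
  have hW : 0 ≤ (if V ^ 2 < 1 + ‖vi‖ ^ 2 + ‖vl‖ ^ 2 then ε * (1 + ‖vi‖ ^ 2 + ‖vl‖ ^ 2)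
      else 0) := by
    split_ifs <;> positivity
  have hR : 0 ≤ ε * ((P * δ + 2 * Q * δ ^ 2) *
      (c⁻¹ ^ 2 * Real.exp (4 * c) * Real.exp (-(2 * c * V ^ 2)))) / 2 := by positivity
  rw [← ENNReal.ofReal_mul hW, ← ENNReal.ofReal_add (Real.exp_pos _).le (Real.exp_pos _).le,
    ← ENNReal.ofReal_mul hR]
  exact ENNReal.ofReal_le_ofReal (weight_mul_window_le hc hε hδ hP hQ V vi vl)

/-! ## The two integrations -/

/-- **Positions first: the pair shell under the hard-core canonical measure.**  If
`F ≤ 𝟙{ε ≤ d(xᵢ, x_l) ≤ ε + w'} · W` pointwise, then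
`∫ F d(posGibbs) ≤ W · (12 v₁ ε² w' + K(ε) w'²)` (`lintegral_indicator_const_le` and
`posGibbsMeasure_pairShell_le`). [folklore] -/
theorem lintegral_posShell_le {b σ : ℝ} (hb : 0 < b) (hσ : 0 < σ) (hσ2 : σ < 1 / 2)
    (hlam : v₁ * σ ^ 3 ≤ 1 / 2) (N : ℕ) {i l : Fin (N + 1)} (hil : i ≠ l) {w' : ℝ}
    (hw' : 0 ≤ w') (W : ℝ≥0∞) {F : (Fin (N + 1) → T3) → ℝ≥0∞}
    (hF : ∀ x, F x ≤ {x : Fin (N + 1) → T3 | hsDiameter σ N ≤ Torus.euclidDist (x i) (x l) ∧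
        Torus.euclidDist (x i) (x l) ≤ hsDiameter σ N + w'}.indicator (fun _ => W) x) :
    ∫⁻ x, F x ∂posGibbsMeasure (fun _ : T3 => b) (hsDiameter σ N) (N + 1) ≤
      W * ENNReal.ofReal (12 * v₁ * hsDiameter σ N ^ 2 * w' +
        (2 ^ 2 * v₁ * (3 * hsDiameter σ N + 1) + (1 / 2 - hsDiameter σ N)⁻¹ ^ 2) * w' ^ 2) :=
  calc ∫⁻ x, F x ∂posGibbsMeasure (fun _ : T3 => b) (hsDiameter σ N) (N + 1)
      ≤ ∫⁻ x, {x : Fin (N + 1) → T3 | hsDiameter σ N ≤ Torus.euclidDist (x i) (x l) ∧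
          Torus.euclidDist (x i) (x l) ≤ hsDiameter σ N + w'}.indicator (fun _ => W) x
          ∂posGibbsMeasure (fun _ : T3 => b) (hsDiameter σ N) (N + 1) := lintegral_mono hF
    _ ≤ W * posGibbsMeasure (fun _ : T3 => b) (hsDiameter σ N) (N + 1)
          {x | hsDiameter σ N ≤ Torus.euclidDist (x i) (x l) ∧
            Torus.euclidDist (x i) (x l) ≤ hsDiameter σ N + w'} :=
        lintegral_indicator_const_le _ _
    _ ≤ _ := mul_le_mul_right (posGibbsMeasure_pairShell_le hb hσ hσ2 hlam N hil hw') _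

/-- **Velocities second: the Gaussian moments of the weighted window.**  Under the product
Maxwellian `⊗ᵢ N(u, θ id)`, if `∫ e^{8c‖v‖²} dN(u, θ id) ≤ K₁` then for coordinates `i, l` and
`P, Q, ε, δ ≥ 0`:
`∫ 𝟙{V² < t} ε t (P δ g + Q δ² g²) ≤ ε (Pδ + 2Qδ²) c⁻² e^{4c} e^{−2cV²} K₁`
(`ofReal_weight_mul_window_le` pointwise, then the one-body exponential moment at the coordinates
`i` and `l`, `measurePreserving_eval`). [folklore] -/
theorem lintegral_weight_window_le {c : ℝ} (hc : 0 < c) {K₁ : ℝ} (hK₁ : 0 ≤ K₁) (u : V3)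
    (θ : ℝ) (hK : ∫⁻ v, ENNReal.ofReal (Real.exp (8 * c * ‖v‖ ^ 2)) ∂gaussMeasure u θ ≤
      ENNReal.ofReal K₁)
    {n : ℕ} (i l : Fin n) {ε δ P Q : ℝ} (hε : 0 ≤ ε) (hδ : 0 ≤ δ) (hP : 0 ≤ P) (hQ : 0 ≤ Q)
    (V : ℝ) :
    ∫⁻ v, ENNReal.ofReal (if V ^ 2 < 1 + ‖v i‖ ^ 2 + ‖v l‖ ^ 2 then
          ε * (1 + ‖v i‖ ^ 2 + ‖v l‖ ^ 2) else 0) *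
        ENNReal.ofReal (P * (δ * ‖v i - v l‖) + Q * (δ * ‖v i - v l‖) ^ 2)
        ∂Measure.pi (fun _ : Fin n => gaussMeasure u θ) ≤
      ENNReal.ofReal (ε * ((P * δ + 2 * Q * δ ^ 2) *
        (c⁻¹ ^ 2 * Real.exp (4 * c) * Real.exp (-(2 * c * V ^ 2))) * K₁)) := by
  have hg : Measurable fun w : V3 => ENNReal.ofReal (Real.exp (8 * c * ‖w‖ ^ 2)) :=
    (Real.measurable_exp.comp ((measurable_norm.pow_const 2).const_mul (8 * c))).ennreal_ofReal
  -- the one-body exponential moment at a coordinate of the product Maxwellian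
  have hIk : ∀ k : Fin n, ∫⁻ v, ENNReal.ofReal (Real.exp (8 * c * ‖v k‖ ^ 2))
      ∂Measure.pi (fun _ : Fin n => gaussMeasure u θ) ≤ ENNReal.ofReal K₁ := fun k =>
    ((measurePreserving_eval (fun _ : Fin n => gaussMeasure u θ) k).lintegral_comp hg).trans_le hK
  have hmi : Measurable fun v : Fin n → V3 => ENNReal.ofReal (Real.exp (8 * c * ‖v i‖ ^ 2)) :=
    hg.comp (measurable_pi_apply i)
  have hR : 0 ≤ ε * ((P * δ + 2 * Q * δ ^ 2) *
      (c⁻¹ ^ 2 * Real.exp (4 * c) * Real.exp (-(2 * c * V ^ 2)))) / 2 := by positivity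
  calc _ ≤ ∫⁻ v, ENNReal.ofReal (ε * ((P * δ + 2 * Q * δ ^ 2) *
          (c⁻¹ ^ 2 * Real.exp (4 * c) * Real.exp (-(2 * c * V ^ 2)))) / 2) *
          (ENNReal.ofReal (Real.exp (8 * c * ‖v i‖ ^ 2)) +
            ENNReal.ofReal (Real.exp (8 * c * ‖v l‖ ^ 2)))
          ∂Measure.pi (fun _ : Fin n => gaussMeasure u θ) :=
        lintegral_mono fun v => ofReal_weight_mul_window_le hc hε hδ hP hQ V (v i) (v l)
    _ = ENNReal.ofReal (ε * ((P * δ + 2 * Q * δ ^ 2) *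
          (c⁻¹ ^ 2 * Real.exp (4 * c) * Real.exp (-(2 * c * V ^ 2)))) / 2) *
          ((∫⁻ v, ENNReal.ofReal (Real.exp (8 * c * ‖v i‖ ^ 2))
              ∂Measure.pi (fun _ : Fin n => gaussMeasure u θ)) +
            ∫⁻ v, ENNReal.ofReal (Real.exp (8 * c * ‖v l‖ ^ 2))
              ∂Measure.pi (fun _ : Fin n => gaussMeasure u θ)) := by
        rw [lintegral_const_mul' _ _ ENNReal.ofReal_ne_top, lintegral_add_left hmi]
    _ ≤ ENNReal.ofReal (ε * ((P * δ + 2 * Q * δ ^ 2) *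
          (c⁻¹ ^ 2 * Real.exp (4 * c) * Real.exp (-(2 * c * V ^ 2)))) / 2) *
          (ENNReal.ofReal K₁ + ENNReal.ofReal K₁) :=
        mul_le_mul_right (add_le_add (hIk i) (hIk l)) _
    _ = _ := by
        rw [← ENNReal.ofReal_add hK₁ hK₁, ← ENNReal.ofReal_mul hR]
        congr 1
        ring

/-! ## The registered sub-goal -/

/-- **The static fast-pair shell with Gaussian weights, `N`-uniformly.**  For constant profiles
`b, ϑ > 0`, `w` there are `A, a > 0` (depending on `w, ϑ` only) such that for `0 < σ < 1/2` with
`v₁σ³ ≤ 1/2`, every `N` and `Φ`, there is `C₂ > 0` with, for all `i ≠ l`, `V ≥ 1`, `δ ≥ 0`: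
under the local Gibbs law `G` of diameter `ε = hsDiameter σ N`,
`∫ 𝟙{ε ≤ ‖sepVec xᵢ x_l‖ ≤ ε + δ‖vᵢ − v_l‖} 𝟙{V² < 1 + ‖vᵢ‖² + ‖v_l‖²} ε (1 + ‖vᵢ‖² + ‖v_l‖²) dG
  ≤ ε (A e^{−aV²} ε² δ + C₂ δ²)`
— product structure `localGibbsMeasure_rung0_eq_map`, positions first (`lintegral_posShell_le`),
then the Gaussian tail and Fernique's exponential moment (`lintegral_weight_window_le`,
`tailsZero_exists_lintegral_exp_gaussMeasure_le`). [folklore] -/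
theorem lintegral_fastPairShell_le :
    ∀ (b ϑ : ℝ) (w : V3), 0 < b → 0 < ϑ → ∃ A a : ℝ, 0 < A ∧ 0 < a ∧ ∀ σ : ℝ, 0 < σ → σ < 2⁻¹ → v₁ * σ ^ 3 ≤ 1 / 2 →
      ∀ (N : ℕ) (Φ : HardSphereFlow (Torus.geometry (Fin 3)) (hsDiameter σ N) (N + 1)), ∃ C₂ : ℝ, 0 < C₂ ∧
        ∀ (i l : Fin (N + 1)), i ≠ l → ∀ V : ℝ, 1 ≤ V → ∀ δ : ℝ, 0 ≤ δ →
          ∫⁻ z, ENNReal.ofReal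
              (if hsDiameter σ N ≤ ‖(Torus.geometry (Fin 3)).sepVec (z i).1 (z l).1‖ ∧
                  ‖(Torus.geometry (Fin 3)).sepVec (z i).1 (z l).1‖ ≤ hsDiameter σ N + δ * ‖(z i).2 - (z l).2‖ then
                (if V ^ 2 < 1 + ‖(z i).2‖ ^ 2 + ‖(z l).2‖ ^ 2 then hsDiameter σ N * (1 + ‖(z i).2‖ ^ 2 + ‖(z l).2‖ ^ 2) else 0)
              else 0)
            ∂(localGibbsLaw σ (fun _ => b) (fun _ => w) (fun _ => ϑ) N Φ) ≤
          ENNReal.ofReal (hsDiameter σ N * (A * Real.exp (-(a * V ^ 2)) * hsDiameter σ N ^ 2 * δ + C₂ * δ ^ 2)) := by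
  intro b ϑ w hb hϑ
  -- Fernique (constant profiles): `∫ e^{a₀‖v‖²} dN(w, ϑ id) ≤ K₀`; put `c = a₀ / 8`, `K₁ = max K₀ 1`
  obtain ⟨a₀, ha₀, K₀, hK₀⟩ := tailsZero_exists_lintegral_exp_gaussMeasure_le
    (θ₀ := fun _ : T3 => ϑ) (u₀ := fun _ : T3 => w) continuous_const continuous_const fun _ => hϑ
  have hK : ∫⁻ v, ENNReal.ofReal (Real.exp (8 * (a₀ / 8) * ‖v‖ ^ 2)) ∂gaussMeasure w ϑ ≤
      ENNReal.ofReal (max K₀ 1) := by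
    rw [show 8 * (a₀ / 8) = a₀ by ring]
    exact (hK₀ 0).trans (ENNReal.ofReal_le_ofReal (le_max_left _ _))
  have hc : 0 < a₀ / 8 := by positivity
  have hK₁ : (0 : ℝ) ≤ max K₀ 1 := zero_le_one.trans (le_max_right _ _)
  have hv := v₁_pos
  refine ⟨12 * v₁ * ((a₀ / 8)⁻¹ ^ 2 * Real.exp (4 * (a₀ / 8)) * max K₀ 1), 2 * (a₀ / 8),
    by positivity, by positivity, ?_⟩
  intro σ hσ hσ2' hlam N Φ
  have hσ2 : σ < 1 / 2 := by simpa only [one_div] using hσ2'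
  have hε : 0 < hsDiameter σ N := hsDiameter_pos hσ N
  have hP : 0 ≤ 12 * v₁ * hsDiameter σ N ^ 2 := by positivity
  have hQ : 0 ≤ 2 ^ 2 * v₁ * (3 * hsDiameter σ N + 1) + (1 / 2 - hsDiameter σ N)⁻¹ ^ 2 := by
    positivity
  refine ⟨2 * (2 ^ 2 * v₁ * (3 * hsDiameter σ N + 1) + (1 / 2 - hsDiameter σ N)⁻¹ ^ 2) *
      ((a₀ / 8)⁻¹ ^ 2 * Real.exp (4 * (a₀ / 8)) * max K₀ 1) + 1, by positivity, ?_⟩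
  intro i l hil V hV δ hδ
  haveI := isProbabilityMeasure_posGibbsMeasure (a₀ := fun _ : T3 => b) continuous_const
    (fun _ => hb) hσ2.le N
  have hz : MeasurableEmbedding
      (zipConfig : (Fin (N + 1) → T3) × (Fin (N + 1) → V3) → Config (N + 1) (Fin 3) T3) :=
    (MeasurableEquiv.arrowProdEquivProdArrow T3 V3 (Fin (N + 1))).symm.measurableEmbedding
  -- product structure, positions inside (Tonelli as an inequality: no measurability needed)
  rw [localGibbsLaw_eq, localGibbsMeasure_rung0_eq_map σ hb.le hϑ w N, hz.lintegral_map,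
    ← lintegral_prod_swap]
  refine (lintegral_prod_le _).trans ?_
  calc _ ≤ ∫⁻ v, ENNReal.ofReal (if V ^ 2 < 1 + ‖v i‖ ^ 2 + ‖v l‖ ^ 2 then
            hsDiameter σ N * (1 + ‖v i‖ ^ 2 + ‖v l‖ ^ 2) else 0) *
          ENNReal.ofReal (12 * v₁ * hsDiameter σ N ^ 2 * (δ * ‖v i - v l‖) +
            (2 ^ 2 * v₁ * (3 * hsDiameter σ N + 1) + (1 / 2 - hsDiameter σ N)⁻¹ ^ 2) *
              (δ * ‖v i - v l‖) ^ 2) ∂Measure.pi (fun _ : Fin (N + 1) => gaussMeasure w ϑ) := by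
        refine lintegral_mono fun v => lintegral_posShell_le hb hσ hσ2 hlam N hil
          (w' := δ * ‖v i - v l‖) (by positivity) _ fun x => ?_
        simp only [Prod.swap_prod_mk, zipConfig_apply, Torus.norm_geometry_sepVec,
          Set.indicator_apply, Set.mem_setOf_eq]
        split_ifs <;> simp
    _ ≤ ENNReal.ofReal (hsDiameter σ N * ((12 * v₁ * hsDiameter σ N ^ 2 * δ +
          2 * (2 ^ 2 * v₁ * (3 * hsDiameter σ N + 1) + (1 / 2 - hsDiameter σ N)⁻¹ ^ 2) * δ ^ 2) *
          ((a₀ / 8)⁻¹ ^ 2 * Real.exp (4 * (a₀ / 8)) * Real.exp (-(2 * (a₀ / 8) * V ^ 2))) *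
            max K₀ 1)) :=
        lintegral_weight_window_le hc hK₁ w ϑ hK i l hε.le hδ hP hQ V
    _ ≤ _ := by
        refine ENNReal.ofReal_le_ofReal (mul_le_mul_of_nonneg_left ?_ hε.le)
        have he1 : Real.exp (-(2 * (a₀ / 8) * V ^ 2)) ≤ 1 :=
          Real.exp_le_one_iff.2 (neg_nonpos.2 (by positivity))
        have hX : 0 ≤ 2 * (2 ^ 2 * v₁ * (3 * hsDiameter σ N + 1) + (1 / 2 - hsDiameter σ N)⁻¹ ^ 2) *
            δ ^ 2 * ((a₀ / 8)⁻¹ ^ 2 * Real.exp (4 * (a₀ / 8))) * max K₀ 1 := by positivity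
        have h2 := mul_le_mul_of_nonneg_left he1 hX
        have hδ2 : 0 ≤ δ ^ 2 := sq_nonneg δ
        nlinarith [h2, hδ2]

end Summit.AtomisticToContinuum.HydrodynamicLimit.Theorems.LambertianContactSwapLambertianEulerFastPairShell

end
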